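import Summits.Langlands.Langlands.Theorems.SoloBlindParallelType
import Literature.NumberTheory.Automorphic.InfinityTypeAutomorphicInduction
import Literature.NumberTheory.Automorphic.WeaklyRegularGaloisRep
import HarnessLib

/-!
# SoloBlindInducedMultiplicity — the induced infinity type of a regular algebraic cusp form over a
# prime-degree mixed-signature field has every exponent with multiplicity divisible by the degree;
# over a complex cubic field it is neither regular nor weakly regular

Solo seat `solo-Langlands-blind`, session 10.  Granted `Clozel1990_regularAlgebraic`, let `K` be a
number field of prime degree `p` with at least one real and at least one complex place (e.g. a
complex cubic field, `p = 3`), `π` a cuspidal regular algebraic representation of `GL_n(𝔸_K)`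
(`n ≥ 1`) and `T` an infinity type of `π`.  By `SoloBlind.map_a_eq_of_finrank_prime` the multiset
`A` of `z`-exponents of `T` is the same at every embedding `K → ℂ`.  Consequently the induced
infinity type `T^{K/ℚ}` (`InfinityType.automorphicInduction ℚ N T`, the archimedean type of the
hypothetical automorphic induction `AI_{K/ℚ}(π)`, equivalently the Hodge–Tate type of
`Ind_{G_K}^{G_ℚ}` of a Galois representation attached to `π`) has `z`-exponent multiset `p • A` at
the embedding of `ℚ`:

* `map_a_automorphicInduction_rat_eq_nsmul` — `(T^{K/ℚ}).a = [K:ℚ] • A`;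
* `finrank_le_count_automorphicInduction_rat` — every exponent that occurs, occurs with
  multiplicity `≥ [K:ℚ]`;
* `three_le_finrank_of_mixedSignature` — a field with a real and a complex place has degree `≥ 3`;
* `not_isWeaklyRegular_automorphicInduction_rat` — hence `T^{K/ℚ}` is NOT weakly regular in the
  sense of Fakhruddin–Pilloni §9.1 (`InfinityType.IsWeaklyRegular`: every exponent of multiplicity
  `≤ 2`), in particular not regular; complex-cubic specialisations `…_of_complexCubic`.

Reading (paper/paper.md §2, wall W1/W2 sharpened, s10): for a field `K` that is neither totally
real nor CM with `[K:K_cm] ≥ 3` no transport of a regular algebraic `π` over `K` to `ℚ` (or to any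
totally real or CM base) is regular or weakly regular, so neither the Shimura-variety constructions
of Galois representations for regular `π` (Harris–Lan–Taylor–Thorne, Scholze) nor those for weakly
regular `π` via coherent cohomology / limits of discrete series (Pilloni–Stroh, Goldring–Koskivirta,
Fakhruddin–Pilloni Thm. 9.10) can see `π`; the boundary case `[K:K_cm] = 2` is the abelian-surface
regime of Boxer–Calegari–Gee–Pilloni.
[cite: Clozel1990, Thm. 3.13 and Lemme 4.9] [cite: Patrikis2019, Prop. 2.4.7 and Rem. 2.4.8 (1)
(arXiv:1207.6724 §3.2)] [cite: FakhruddinPilloni2021, §9.1 (Weakly regular)]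
[cite: Henniart2012, Thm. 5 and Remarque finale §3.7]
-/

open scoped Classical
open NumberField NumberField.ComplexEmbedding Module Finset
open Literature.NumberTheory.NumberFields Literature.NumberTheory.Automorphic

namespace Summit.Langlands.Langlands.Theorems
namespace SoloBlind

/-! ### Multiset and field lemmas -/

section Lemmas

/-- A multiset of the form `m • A` with `m ≥ 3` and `A ≠ 0` is not a sum of two multisets without
repetition. -/
theorem not_exists_nodup_add_of_nsmul {α : Type*} [DecidableEq α] {A : Multiset α} (hA : A ≠ 0)
    {m : ℕ} (hm : 3 ≤ m) :
    ¬ ∃ μ ν : Multiset α, m • A = μ + ν ∧ μ.Nodup ∧ ν.Nodup := by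
  rintro ⟨μ, ν, hμν, hμ, hν⟩
  obtain ⟨x, hx⟩ := Multiset.exists_mem_of_ne_zero hA
  have h1 : m ≤ Multiset.count x (m • A) := by
    rw [Multiset.count_nsmul]
    exact Nat.le_mul_of_pos_right m (Multiset.count_pos.mpr hx)
  have h2 : Multiset.count x (μ + ν) ≤ 2 := by
    rw [Multiset.count_add]
    have := Multiset.nodup_iff_count_le_one.mp hμ x
    have := Multiset.nodup_iff_count_le_one.mp hν x
    omega
  rw [hμν] at h1
  omega

variable {K : Type*} [Field K] [NumberField K]

/-- A number field with a real place and a complex place has degree at least `3`. -/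
theorem three_le_finrank_of_mixedSignature (hr : ¬ IsTotallyReal K) (hc : ¬ IsTotallyComplex K) :
    3 ≤ finrank ℚ K := by
  have h := InfinitePlace.card_add_two_mul_card_eq_rank K
  have h1 : InfinitePlace.nrRealPlaces K ≠ 0 := fun h0 ↦
    hc (nrRealPlaces_eq_zero_iff.mp h0)
  have h2 : InfinitePlace.nrComplexPlaces K ≠ 0 := fun h0 ↦
    hr (nrComplexPlaces_eq_zero_iff.mp h0)
  omega

end Lemmas

/-! ### The induced type over `ℚ` -/

section Induced

variable {K : Type} [Field K] [NumberField K] {n N : ℕ}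

/-- Over `ℚ` every embedding of `K` lies over the (unique) embedding of `ℚ`, so the induced type
collects ALL embeddings: if the `z`-exponent multiset of `T` is the same multiset `A` at every
embedding, the induced type has exponent multiset `[K:ℚ] • A`. [folklore] -/
theorem map_a_automorphicInduction_rat_eq_nsmul (T : InfinityType K n) (ι₀ : K →+* ℂ)
    (hT : ∀ ι : K →+* ℂ, (T ι).map ArchWeight.a = (T ι₀).map ArchWeight.a) (σ : ℚ →+* ℂ) :
    (T.automorphicInduction ℚ N σ).map ArchWeight.a = finrank ℚ K • (T ι₀).map ArchWeight.a := by
  rw [InfinityType.map_automorphicInduction]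
  have hfilter : Finset.univ.filter (fun ι : K →+* ℂ ↦ ι.comp (algebraMap ℚ K) = σ) =
      Finset.univ :=
    Finset.filter_true_of_mem fun ι _ ↦ RingHom.ext_rat _ _
  rw [hfilter, Finset.sum_congr rfl fun ι _ ↦ hT ι, Finset.sum_const, Finset.card_univ,
    NumberField.Embeddings.card K ℂ]

/-- **Multiplicity at least the degree.**  Granted `Clozel1990_regularAlgebraic`: over a number
field `K` of prime degree with mixed signature, every `z`-exponent of the induced type
`T^{K/ℚ}` of an infinity type `T` of a cuspidal regular algebraic `π` occurs with multiplicity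
divisible by, and hence at least, `[K:ℚ]`.
[cite: Patrikis2019, Prop. 2.4.7 and Rem. 2.4.8 (1)] [cite: Clozel1990, Thm. 3.13 and Lemme 4.9] -/
theorem count_automorphicInduction_rat_eq (hC : Clozel1990_regularAlgebraic)
    (hp : (finrank ℚ K).Prime) (hr : ¬ IsTotallyReal K) (hc : ¬ IsTotallyComplex K)
    {hcpt : isCompact_glFiniteIntegralLevel n K} (π : CuspidalAutomorphicRepData n K hcpt)
    (hπ : π.1.IsRegularAlgebraic) {T : InfinityType K n} (hT : π.1.HasInfinityType T)
    (ι₀ : K →+* ℂ) (σ : ℚ →+* ℂ) (x : ℂ) :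
    ((T.automorphicInduction ℚ N σ).map ArchWeight.a).count x =
      finrank ℚ K * ((T ι₀).map ArchWeight.a).count x := by
  rw [map_a_automorphicInduction_rat_eq_nsmul T ι₀
    (fun ι ↦ map_a_eq_of_finrank_prime hC hp hr hc π hπ hT ι ι₀) σ, Multiset.count_nsmul]

/-- Every exponent of `T^{K/ℚ}` that occurs has multiplicity `≥ [K:ℚ] ≥ 3`.
[cite: Patrikis2019, Prop. 2.4.7 and Rem. 2.4.8 (1)] [cite: Clozel1990, Thm. 3.13 and Lemme 4.9] -/
theorem finrank_le_count_automorphicInduction_rat (hC : Clozel1990_regularAlgebraic)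
    (hp : (finrank ℚ K).Prime) (hr : ¬ IsTotallyReal K) (hc : ¬ IsTotallyComplex K)
    {hcpt : isCompact_glFiniteIntegralLevel n K} (π : CuspidalAutomorphicRepData n K hcpt)
    (hπ : π.1.IsRegularAlgebraic) {T : InfinityType K n} (hT : π.1.HasInfinityType T)
    (σ : ℚ →+* ℂ) {x : ℂ} (hx : x ∈ (T.automorphicInduction ℚ N σ).map ArchWeight.a) :
    finrank ℚ K ≤ ((T.automorphicInduction ℚ N σ).map ArchWeight.a).count x := by
  obtain ⟨ι₀⟩ : Nonempty (K →+* ℂ) := by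
    rw [← Fintype.card_pos_iff, NumberField.Embeddings.card K ℂ]
    exact Module.finrank_pos
  have hx' : 0 < ((T ι₀).map ArchWeight.a).count x := by
    have h := Multiset.count_pos.mpr hx
    rw [count_automorphicInduction_rat_eq hC hp hr hc π hπ hT ι₀ σ x] at h
    refine Nat.pos_of_ne_zero fun h0 ↦ ?_
    rw [h0, mul_zero] at h
    exact lt_irrefl 0 h
  rw [count_automorphicInduction_rat_eq hC hp hr hc π hπ hT ι₀ σ x]
  exact Nat.le_mul_of_pos_right _ hx'

/-- **Not weakly regular.**  Granted `Clozel1990_regularAlgebraic`: over a number field `K` of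
prime degree with mixed signature and for `n ≥ 1`, the induced type `T^{K/ℚ}` of a cuspidal
regular algebraic `π` on `GL_n(𝔸_K)` is not weakly regular (Fakhruddin–Pilloni §9.1: some exponent
has multiplicity `≥ 3`), whatever nominal rank `N` it is given.
[cite: FakhruddinPilloni2021, §9.1 (Weakly regular)] [cite: Patrikis2019, Prop. 2.4.7 and
Rem. 2.4.8 (1)] [cite: Clozel1990, Thm. 3.13 and Lemme 4.9] -/
theorem not_isWeaklyRegular_automorphicInduction_rat (hC : Clozel1990_regularAlgebraic)
    (hp : (finrank ℚ K).Prime) (hr : ¬ IsTotallyReal K) (hc : ¬ IsTotallyComplex K)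
    (hn : n ≠ 0) {hcpt : isCompact_glFiniteIntegralLevel n K}
    (π : CuspidalAutomorphicRepData n K hcpt) (hπ : π.1.IsRegularAlgebraic)
    {T : InfinityType K n} (hT : π.1.HasInfinityType T) :
    ¬ (T.automorphicInduction ℚ N).IsWeaklyRegular := by
  intro hW
  obtain ⟨ι₀⟩ : Nonempty (K →+* ℂ) := by
    rw [← Fintype.card_pos_iff, NumberField.Embeddings.card K ℂ]
    exact Module.finrank_pos
  obtain ⟨σ⟩ : Nonempty (ℚ →+* ℂ) := ⟨Rat.castHom ℂ⟩
  obtain ⟨μ, ν, hμν, -, hμ, hν⟩ := hW σ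
  rw [map_a_automorphicInduction_rat_eq_nsmul T ι₀
    (fun ι ↦ map_a_eq_of_finrank_prime hC hp hr hc π hπ hT ι ι₀) σ] at hμν
  have hA : (T ι₀).map ArchWeight.a ≠ 0 := by
    intro h0
    have hcard := hT.1.1 ι₀
    rw [← Multiset.card_map ArchWeight.a, h0, Multiset.card_zero] at hcard
    exact hn hcard.symm
  exact not_exists_nodup_add_of_nsmul hA (three_le_finrank_of_mixedSignature hr hc)
    ⟨μ, ν, hμν, hμ, hν⟩

/-- **Not regular either** (the special case: a regular type with `N` exponents is weakly regular;
here directly: an exponent of multiplicity `≥ 3` repeats). [cite: Clozel1990, Déf. 3.12]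
[cite: Patrikis2019, Prop. 2.4.7 and Rem. 2.4.8 (1)] -/
theorem not_isRegular_automorphicInduction_rat (hC : Clozel1990_regularAlgebraic)
    (hp : (finrank ℚ K).Prime) (hr : ¬ IsTotallyReal K) (hc : ¬ IsTotallyComplex K)
    (hn : n ≠ 0) {hcpt : isCompact_glFiniteIntegralLevel n K}
    (π : CuspidalAutomorphicRepData n K hcpt) (hπ : π.1.IsRegularAlgebraic)
    {T : InfinityType K n} (hT : π.1.HasInfinityType T) :
    ¬ (T.automorphicInduction ℚ N).IsRegular := by
  intro hreg
  obtain ⟨ι₀⟩ : Nonempty (K →+* ℂ) := by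
    rw [← Fintype.card_pos_iff, NumberField.Embeddings.card K ℂ]
    exact Module.finrank_pos
  let σ : ℚ →+* ℂ := Rat.castHom ℂ
  have hnd := hreg σ
  rw [map_a_automorphicInduction_rat_eq_nsmul T ι₀
    (fun ι ↦ map_a_eq_of_finrank_prime hC hp hr hc π hπ hT ι ι₀) σ] at hnd
  have hA : (T ι₀).map ArchWeight.a ≠ 0 := by
    intro h0
    have hcard := hT.1.1 ι₀
    rw [← Multiset.card_map ArchWeight.a, h0, Multiset.card_zero] at hcard
    exact hn hcard.symm
  obtain ⟨x, hx⟩ := Multiset.exists_mem_of_ne_zero hA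
  have h1 := Multiset.nodup_iff_count_le_one.mp hnd x
  rw [Multiset.count_nsmul] at h1
  have h3 := three_le_finrank_of_mixedSignature hr hc
  have hpos := Multiset.count_pos.mpr hx
  nlinarith

/-- **Complex cubic fields.**  Granted `Clozel1990_regularAlgebraic`: over a complex cubic field,
the induced type to `ℚ` of any infinity type of a cuspidal regular algebraic `π` on `GL_n`
(`n ≥ 1`) is not weakly regular: every exponent has multiplicity a positive multiple of `3`.
[cite: FakhruddinPilloni2021, §9.1 (Weakly regular)] [cite: Patrikis2019, Prop. 2.4.7 and
Rem. 2.4.8 (1)] [cite: Clozel1990, Thm. 3.13 and Lemme 4.9] -/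
theorem not_isWeaklyRegular_automorphicInduction_rat_of_complexCubic
    (hC : Clozel1990_regularAlgebraic) (h3 : finrank ℚ K = 3) (hr : ¬ IsTotallyReal K)
    (hn : n ≠ 0) {hcpt : isCompact_glFiniteIntegralLevel n K}
    (π : CuspidalAutomorphicRepData n K hcpt) (hπ : π.1.IsRegularAlgebraic)
    {T : InfinityType K n} (hT : π.1.HasInfinityType T) :
    ¬ (T.automorphicInduction ℚ N).IsWeaklyRegular :=
  not_isWeaklyRegular_automorphicInduction_rat hC (h3 ▸ Nat.prime_three) hr
    (not_isTotallyComplex_of_odd_finrank (h3 ▸ (by decide : Odd 3))) hn π hπ hT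

/-- The exponent count over a complex cubic field: `3 ×` the count at any single embedding.
[cite: Patrikis2019, Prop. 2.4.7 and Rem. 2.4.8 (1)] [cite: Clozel1990, Thm. 3.13 and Lemme 4.9] -/
theorem count_automorphicInduction_rat_of_complexCubic (hC : Clozel1990_regularAlgebraic)
    (h3 : finrank ℚ K = 3) (hr : ¬ IsTotallyReal K)
    {hcpt : isCompact_glFiniteIntegralLevel n K} (π : CuspidalAutomorphicRepData n K hcpt)
    (hπ : π.1.IsRegularAlgebraic) {T : InfinityType K n} (hT : π.1.HasInfinityType T)
    (ι₀ : K →+* ℂ) (σ : ℚ →+* ℂ) (x : ℂ) :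
    ((T.automorphicInduction ℚ N σ).map ArchWeight.a).count x =
      3 * ((T ι₀).map ArchWeight.a).count x := by
  rw [← h3]
  exact count_automorphicInduction_rat_eq hC (h3 ▸ Nat.prime_three) hr
    (not_isTotallyComplex_of_odd_finrank (h3 ▸ (by decide : Odd 3))) π hπ hT ι₀ σ x

end Induced

end SoloBlind
end Summit.Langlands.Langlands.Theorems
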